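import Summits.QuantumFields.YangMills.Theorems.HypercubicLimit.Negative.TelescopingGuards

/-!
# `HypercubicLimit` — line `conditional-mean-telescoping`: the fit guard of (T) is decoration

Support file for crux `stmt-QuantumFields-8646` (`HypercubicLimit`), refuter side (drefute gen 4), about
the registered stub `stub_telescoping` of `Cruxes/HypercubicLimit/Lines/conditional-mean-telescoping.lean`
(lead's reshape 2, skeleton sha `66f5c10f…`).  Its first conjunct (T) (`ConditionalMeanTelescoping.
TelescopingBound`, also the shape of `GaussianDomination`) carries two guards besides the orientation
guard: the torus-aliasing clause `|x k μ - x l μ| ≤ S` inside the separation hypothesis — LOAD-BEARING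
(`not_telescopingBoundWithoutLeS`, gen 3) — and the fit guard `4R+4 < 2S+1`.  Here the fit guard is shown
to be PURE DECORATION, kernel-checked: `telescopingBoundNoFit_iff` — (T) with the fit guard deleted is
EQUIVALENT to (T).  For `n ≥ 2` points the separation hypothesis at any pair gives `2R+2 ≤ S`, hence the
guard (`fit_of_separated`); for `n ≤ 1` the bound holds outright (`telescoping_body_zero`,
`telescoping_body_one`: `|∫ 1| = 1 ≤ 1`, resp. `|∫ (p − ⟨p⟩)| = 0 ≤ ‖·‖₁`).  So a prover of (T) may assume
`2 ≤ n` and discard the fit guard, and no refutation can come from the regime it excludes.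

Objects: `cubeEdges/cubeEdgesT/exterior/influence` and `torusPlaquette` are the tree mirrors of
`TelescopingGuards.lean` / `ReflectedDensity.lean` (verbatim copies of the line's objects), so the right-hand
side of `telescopingBoundNoFit_iff` is `ConditionalMeanTelescoping.TelescopingBound` symbol for symbol (no
`def … : Prop` is introduced: the two statements are written inline).
-/

noncomputable section

open scoped ENNReal
open MeasureTheory Filter Topology ProbabilityTheory
open Literature.MathematicalPhysics.AQFT Literature.MathematicalPhysics.QuantumLattice
open Literature.MathematicalPhysics.QuantumFieldTheory

namespace Summit.QuantumFields.YangMills.Theorems.HypercubicLimit.Negative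

/-- **The separation hypothesis at one pair of distinct indices already implies the fit guard**:
`2R+1 < |x k μ − x l μ| ≤ S` gives `2R+2 ≤ S`, i.e. `4R+4 ≤ 2S < 2S+1`. [folklore] -/
theorem fit_of_separated {n R S : ℕ} {x : Fin n → (Fin 4 → ℤ)} {k l : Fin n} (hkl : k ≠ l)
    (hsep : ∀ k l, k ≠ l → ∃ μ : Fin 4, (2 * R + 1 : ℤ) < |x k μ - x l μ| ∧ |x k μ - x l μ| ≤ S) :
    4 * R + 4 < 2 * S + 1 := by
  obtain ⟨μ, h1, h2⟩ := hsep k l hkl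
  have h : (2 * R + 1 : ℤ) < S := lt_of_lt_of_le h1 h2
  omega

section SmallN

variable {G : Type} [Group G] [TopologicalSpace G] [IsTopologicalGroup G] [CompactSpace G]
  [MeasurableSpace G] [BorelSpace G]

/-- The torus plaquette is integrable under the Wilson measure (bounded by `N`, measurable). [folklore] -/
theorem integrable_torusPlaquette (r : LatticeRep G) (β : ℝ) (S : ℕ) (i j : Fin 4) (x : Fin 4 → ℤ) :
    Integrable (torusPlaquette r (2 * S + 1) i j x) (wilsonMeasure (d := 4) (L := 2 * S + 1) r.ρ β) := by
  haveI := isProbabilityMeasure_wilsonMeasure (d := 4) (L := 2 * S + 1) r.ρ r.continuous β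
  refine Integrable.of_bound (measurable_torusPlaquette r (2 * S + 1) i j x).aestronglyMeasurable r.N
    (Eventually.of_forall fun U => ?_)
  rw [Real.norm_eq_abs]
  exact abs_plaquetteObs_le_holds (ρ := r.ρ) r.mem_unitary x i j _

/-- **(T) at `n = 0` holds outright**: `|∫ 1 dμ| = 1 ≤ 1` (empty products). [folklore] -/
theorem telescoping_body_zero (r : LatticeRep G) (β : ℝ) (S R : ℕ)
    (o : Fin 0 → Fin 4 × Fin 4) (x : Fin 0 → (Fin 4 → ℤ)) :
    let μ := wilsonMeasure (d := 4) (L := 2 * S + 1) r.ρ β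
    |∫ U, ∏ k, (torusPlaquette r (2 * S + 1) (o k).1 (o k).2 (x k) U -
        ∫ V, torusPlaquette r (2 * S + 1) (o k).1 (o k).2 (x k) V ∂μ) ∂μ|
      ≤ ∏ k, influence r β S R (x k) (o k).1 (o k).2 (0 : ℕ) := by
  haveI := isProbabilityMeasure_wilsonMeasure (d := 4) (L := 2 * S + 1) r.ρ r.continuous β
  simp

/-- **(T) at `n = 1` holds outright**: the centred plaquette has mean zero, the right-hand side is a
norm. [folklore] -/
theorem telescoping_body_one (r : LatticeRep G) (β : ℝ) (S R : ℕ)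
    (o : Fin 1 → Fin 4 × Fin 4) (x : Fin 1 → (Fin 4 → ℤ)) :
    let μ := wilsonMeasure (d := 4) (L := 2 * S + 1) r.ρ β
    |∫ U, ∏ k, (torusPlaquette r (2 * S + 1) (o k).1 (o k).2 (x k) U -
        ∫ V, torusPlaquette r (2 * S + 1) (o k).1 (o k).2 (x k) V ∂μ) ∂μ|
      ≤ ∏ k, influence r β S R (x k) (o k).1 (o k).2 (1 : ℕ) := by
  haveI := isProbabilityMeasure_wilsonMeasure (d := 4) (L := 2 * S + 1) r.ρ r.continuous β
  simp only [Fin.prod_univ_one]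
  rw [integral_sub (integrable_torusPlaquette r β S _ _ _) (integrable_const _), integral_const,
    probReal_univ, one_smul, sub_self, abs_zero]
  exact ENNReal.toReal_nonneg

end SmallN

/-- **The fit guard `4R+4 < 2S+1` of (T) is decoration**: (T) with the guard deleted (left) is equivalent to
(T) (right; = `ConditionalMeanTelescoping.TelescopingBound` symbol for symbol over the tree mirrors of the line's
objects).  (`→`: a fortiori.  `←`: for `n ≥ 2` the separation hypothesis at the pair `0 ≠ 1` yields the guard
(`fit_of_separated`); for `n = 0, 1` the body holds outright.)  Contrast: the clause `|x k μ - x l μ| ≤ S` of the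
same hypothesis is load-bearing (`not_telescopingBoundWithoutLeS`). [folklore] -/
theorem telescopingBoundNoFit_iff :
    (∀ (G : Type) [Group G] [TopologicalSpace G] [IsTopologicalGroup G] [CompactSpace G]
        [MeasurableSpace G] [BorelSpace G] (r : LatticeRep G) (β : ℝ) (S R n : ℕ)
        (o : Fin n → Fin 4 × Fin 4) (x : Fin n → (Fin 4 → ℤ)),
        (∀ k, (o k).1 ≠ (o k).2) →
        (∀ k l, k ≠ l → ∃ μ : Fin 4, (2 * R + 1 : ℤ) < |x k μ - x l μ| ∧ |x k μ - x l μ| ≤ S) →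
          let μ := wilsonMeasure (d := 4) (L := 2 * S + 1) r.ρ β
          |∫ U, ∏ k, (torusPlaquette r (2 * S + 1) (o k).1 (o k).2 (x k) U -
              ∫ V, torusPlaquette r (2 * S + 1) (o k).1 (o k).2 (x k) V ∂μ) ∂μ|
            ≤ ∏ k, influence r β S R (x k) (o k).1 (o k).2 n) ↔
    (∀ (G : Type) [Group G] [TopologicalSpace G] [IsTopologicalGroup G] [CompactSpace G]
        [MeasurableSpace G] [BorelSpace G] (r : LatticeRep G) (β : ℝ) (S R n : ℕ)
        (o : Fin n → Fin 4 × Fin 4) (x : Fin n → (Fin 4 → ℤ)),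
        (∀ k, (o k).1 ≠ (o k).2) →
        4 * R + 4 < 2 * S + 1 →
        (∀ k l, k ≠ l → ∃ μ : Fin 4, (2 * R + 1 : ℤ) < |x k μ - x l μ| ∧ |x k μ - x l μ| ≤ S) →
          let μ := wilsonMeasure (d := 4) (L := 2 * S + 1) r.ρ β
          |∫ U, ∏ k, (torusPlaquette r (2 * S + 1) (o k).1 (o k).2 (x k) U -
              ∫ V, torusPlaquette r (2 * S + 1) (o k).1 (o k).2 (x k) V ∂μ) ∂μ|
            ≤ ∏ k, influence r β S R (x k) (o k).1 (o k).2 n) := by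
  constructor
  · intro h G _ _ _ _ _ _ r β S R n o x ho _ hsep
    exact h G r β S R n o x ho hsep
  · intro h G _ _ _ _ _ _ r β S R n o x ho hsep
    match n, o, x, ho, hsep with
    | 0, o, x, _, _ => exact telescoping_body_zero r β S R o x
    | 1, o, x, _, _ => exact telescoping_body_one r β S R o x
    | (n + 2), o, x, ho, hsep =>
      have h01 : (0 : Fin (n + 2)) ≠ 1 := by simp
      exact h G r β S R (n + 2) o x ho (fit_of_separated h01 hsep) hsep

end Summit.QuantumFields.YangMills.Theorems.HypercubicLimit.Negative

end
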